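import Literature.MathematicalPhysics.QuantumFieldTheory.Balaban1983to89.T4ShellMeasureDet
import Summits.QuantumFields.BalabanUV.T4Continuum.Support.ShellMeasureLogConcaveSUN

/-!
# N21 (NE7c) · FRAME TRANSFER for the response road's (M1): from part 34's frame `Unit × (Fin n → ℝ)`, cut-restricted,
# to the flat chart law on pub-balaban's block chart space `BlockChartSU N Λ` — the three bookkeeping steps between
# file 8's ★★★★ and dag-n21-w2's `hchart` (W-SEAT START-LIST v8 §n21; JUNCTION №3 l.27652)

Width seat `pub-ymgap-dag-n21-w3` (g2), node N21 = NE7c (NOT PRINTED in [Bałaban 1983–89], NOT proved), lane K3⁷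
`SpineGivenEndpointR13SepCoPH` (stmt-QuantumFields-20544, `--kind proof --supports … --as helper`).  File 11 of this
seat's response road; consumes BY NAME `T4ShellMeasureDet` (`slotAntiConcentration_withDensity_comap`,
`slotAntiConcentration_withDensity_map`) and pub-balaban's `ShellMeasureLogConcaveSUN.measurePreserving_flatCoords`
(flat coordinates `ℝⁿ → BlockChartSU N Λ` are measure preserving); Mathlib `Measure.dirac_prod`.

WHY.  File 8's ★★★★ (part 34 with `hRT` discharged) concludes
`SlotAntiConcentration ((((dirac ()) ⊗ volume).withDensity g)|({U < θ} ∩ C)) U θ ρ D` on the product frame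
`Z × (κ → ℝ)` (one fibre: `Z = Unit`, `κ = Fin n`); dag-n21-w2's JUNCTION №3 (`…ShellSplitOfRecord13CoPHChart`,
`slotAC_blockFibreLaw_of_chartAC`) consumes `hchart : SlotAntiConcentration (volume.withDensity W) Ū θ ρ Dc` on the
flat block chart space `BlockChartSU N Λ` (`W = chartWeightSU · R ∘ expFibreChartSU`, `Ū = blockReading u Λ x ∘
expFibreChartSU Λ c`).  Between the two sit THREE pieces of pure bookkeeping, typed here once so that no consumer
re-derives them: (§1) a CUT-RESTRICTED (M1) is an unrestricted one when the shell lies in the cut; (§2) the `dirac ()`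
factor of a one-fibre product frame is transparent (`Prod.mk ()` is measure preserving into `dirac () ⊗ ν`); (§3) the
NATURAL unflattening `unflat : (↥Λ × Fin d_N → ℝ) → BlockChartSU N Λ`, `y ↦ (b ↦ (y (b, i))_i)` — the frame of file
10 §5 and of file 8's ★★★★ with `κ = ↥Λ × Fin d_N` — is measure preserving (pub-balaban's `measurePreserving_flatCoords`
along any enumeration, the enumeration cancelled by Mathlib's `volume_measurePreserving_piCongrLeft`) and transports
(M1) for `volume.withDensity (W ∘ unflat)`, `Ū ∘ unflat` to (M1) for `volume.withDensity W`, `Ū` (`T4ShellMeasureDet`);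
§4 composes them.  What is NOT here (and not this seat's): the density dictionary `g ((), ·) = W ∘ unflat` itself — part 34's `𝟙_K·exp(−½⟨w−m, A(w−m)⟩ − P)` against
`chartWeightSU · R ∘ expFibreChartSU` (window, Haar Jacobian, dressed factor: n21-d road II ∕ pub-balaban).

WHAT IS PROVED ([bookkeeping]; 0 def, 0 sorry).
* §1 `slotAntiConcentration_of_restrict_cut`: `(M1)` for `μ|({u<θ} ∩ C)` and shell `⊆ C` ⇒ `(M1)` for `μ`, same `θ ρ D`.
* §2 `measurePreserving_prodMk_unit`, `slotAntiConcentration_of_dirac_prod` (product frame `Unit × Y` → `Y`),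
  `slotAntiConcentration_dirac_prod_of` (`Y` → product frame).
* §3 `measurePreserving_unflat` (the NATURAL unflattening `y ↦ (b ↦ (y (b,i))_i)` from `↥Λ × Fin d_N → ℝ` to
  `BlockChartSU N Λ` is measure preserving — pub-balaban's `measurePreserving_flatCoords` along any enumeration, the
  enumeration cancelled), `slotAntiConcentration_blockChartSU_of_unflat`: flat frame → `BlockChartSU N Λ`.
* §4 ★ `slotAntiConcentration_blockChartSU_of_partFrame`: all three at once — from the ★★★★-shaped conclusion on
  `Unit × (↥Λ × Fin d_N → ℝ)` (file 8 ∕ file 12 frame with `Z = Unit`) with shell `⊆ C`, `g`∕`u` measurable and the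
  dictionary `g ((), y) = W (unflat y)`, `u ((), y) = Ū (unflat y)`, to `hchart`'s shape on `BlockChartSU N Λ`.

HONEST FRAMING.  [bookkeeping] transports BY NAME; no density dictionary, window, Jacobian or dressed factor is
asserted or typed; nothing of Bałaban's asserted; (M1) ∕ NE7c NOT PRINTED ∕ NOT proved; N21 NOT discharged; K3⁷ NOT
claimed; counts unmoved (typed 28∕28 · discharged 5∕27); count-neutral; one finite 𝕋⁴ at fixed ε — YM mass gap
(Clay) is NOT proved by any of this: R4 closes the conditional finite-𝕋⁴ rung `BalabanLadder.UV` only; nothing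
continuum ∕ ℝ⁴ ∕ OS ∕ mass gap ∕ Clay.
-/

noncomputable section

open MeasureTheory Set
open scoped ENNReal

namespace Summit.QuantumFields.YangMills.Theorems.N21ResponseRoadFrameTransfer

open Literature.MathematicalPhysics.QuantumFieldTheory.Balaban1983to89
open T4ShellMeasure (SlotAntiConcentration)
open T4ShellMeasureDet (slotAntiConcentration_withDensity_comap slotAntiConcentration_withDensity_map)
open Summit.QuantumFields.BalabanUV.T4Continuum.ShellMeasureExpChartSUN
open Summit.QuantumFields.BalabanUV.T4Continuum.ShellMeasureLogConcaveSUN (measurePreserving_flatCoords)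

/-! ## §1  A cut-restricted (M1) is an unrestricted (M1) when the shell lies in the cut -/

/-- **(M1) FOR THE CUT LAW ⇒ (M1) FOR THE WHOLE LAW** when the shell `{θ(1−ρ) ≤ u < θ}` lies in the cut `C`
(part 34 ∕ file 8 ★★★★ conclude for `μ|({u<θ} ∩ C)`; the shell is below `θ` automatically): same `θ ρ D`.
[bookkeeping] -/
theorem slotAntiConcentration_of_restrict_cut {Ω : Type*} [MeasurableSpace Ω] (μ : Measure Ω) {u : Ω → ℝ}
    (hu : Measurable u) {C : Set Ω} {θ ρ D : ℝ}
    (hC : ∀ x, θ * (1 - ρ) ≤ u x → u x < θ → x ∈ C)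
    (h : SlotAntiConcentration (μ.restrict ({x | u x < θ} ∩ C)) u θ ρ D) :
    SlotAntiConcentration μ u θ ρ D := by
  unfold T4ShellMeasure.SlotAntiConcentration at h ⊢
  have hS : MeasurableSet {x | θ * (1 - ρ) ≤ u x ∧ u x < θ} :=
    (measurableSet_le measurable_const hu).inter (measurableSet_lt hu measurable_const)
  have hsub : {x | θ * (1 - ρ) ≤ u x ∧ u x < θ} ⊆ {x | u x < θ} ∩ C :=
    fun x hx => ⟨hx.2, hC x hx.1 hx.2⟩
  rw [Measure.restrict_apply hS, inter_eq_left.2 hsub, Measure.restrict_apply_univ] at h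
  exact h.trans (mul_le_mul_right (measure_mono (subset_univ _)) _)

/-! ## §2  The `dirac ()` factor of a one-fibre product frame is transparent -/

/-- `y ↦ ((), y)` pushes `ν` to `dirac () ⊗ ν`. [bookkeeping] -/
theorem measurePreserving_prodMk_unit {Y : Type*} [MeasurableSpace Y] (ν : Measure Y) [SFinite ν] :
    MeasurePreserving (Prod.mk () : Y → Unit × Y) ν ((Measure.dirac ()).prod ν) :=
  ⟨measurable_prodMk_left, (Measure.dirac_prod () (ν := ν)).symm⟩

/-- **PRODUCT FRAME → FIBRE**: (M1) for `(dirac () ⊗ ν).withDensity g` and `u` gives (M1) for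
`ν.withDensity (g ((), ·))` and `u ((), ·)`, same constants. [bookkeeping] -/
theorem slotAntiConcentration_of_dirac_prod {Y : Type*} [MeasurableSpace Y] (ν : Measure Y) [SFinite ν]
    {g : Unit × Y → ℝ≥0∞} (hg : Measurable g) {u : Unit × Y → ℝ} {θ ρ D : ℝ}
    (h : SlotAntiConcentration (((Measure.dirac ()).prod ν).withDensity g) u θ ρ D) :
    SlotAntiConcentration (ν.withDensity fun y => g ((), y)) (fun y => u ((), y)) θ ρ D :=
  slotAntiConcentration_withDensity_comap (measurePreserving_prodMk_unit ν) hg h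

/-- **FIBRE → PRODUCT FRAME** (`u` measurable): the converse transport. [bookkeeping] -/
theorem slotAntiConcentration_dirac_prod_of {Y : Type*} [MeasurableSpace Y] (ν : Measure Y) [SFinite ν]
    {g : Unit × Y → ℝ≥0∞} (hg : Measurable g) {u : Unit × Y → ℝ} (hu : Measurable u) {θ ρ D : ℝ}
    (h : SlotAntiConcentration (ν.withDensity fun y => g ((), y)) (fun y => u ((), y)) θ ρ D) :
    SlotAntiConcentration (((Measure.dirac ()).prod ν).withDensity g) u θ ρ D :=
  slotAntiConcentration_withDensity_map (measurePreserving_prodMk_unit ν) hg hu h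

/-! ## §3  Flat coordinates `(↥Λ × Fin d_N → ℝ) → BlockChartSU N Λ` transport (M1) — NO enumeration in the statement -/

variable {N : ℕ} {P : Params} {j : ℕ}

/-- **THE NATURAL UNFLATTENING IS MEASURE PRESERVING**: `y ↦ (b ↦ (y (b, i))_i)` from the flat frame
`↥Λ × Fin d_N → ℝ` (Lebesgue) to `BlockChartSU N Λ` (product of the Euclidean volumes) — pub-balaban's
`measurePreserving_flatCoords` along ANY enumeration `e : ↥Λ × Fin d_N ≃ Fin n` composed with Mathlib's reindexing
`volume_measurePreserving_piCongrLeft`; the enumeration cancels (`piCongrLeft_apply_apply`). [bookkeeping] -/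
theorem measurePreserving_unflat (Λ : Finset (PBond P j)) :
    MeasurePreserving (fun (y : ↥Λ × Fin (dimSU N) → ℝ) (b : ↥Λ) =>
      (WithLp.toLp 2 fun i : Fin (dimSU N) => y (b, i) : ChartSU N)) volume volume := by
  classical
  obtain ⟨e⟩ : Nonempty (↥Λ × Fin (dimSU N) ≃ Fin (Fintype.card (↥Λ × Fin (dimSU N)))) :=
    ⟨Fintype.equivFin _⟩
  have h := (measurePreserving_flatCoords (N := N) Λ e).comp
    (volume_measurePreserving_piCongrLeft (fun _ : Fin (Fintype.card (↥Λ × Fin (dimSU N))) => ℝ) e)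
  have hfun : ((fun (u : Fin (Fintype.card (↥Λ × Fin (dimSU N))) → ℝ) (b : ↥Λ) =>
        (WithLp.toLp 2 fun i : Fin (dimSU N) => u (e (b, i)) : ChartSU N)) ∘
        ⇑(MeasurableEquiv.piCongrLeft (fun _ : Fin (Fintype.card (↥Λ × Fin (dimSU N))) => ℝ) e)) =
      fun (y : ↥Λ × Fin (dimSU N) → ℝ) (b : ↥Λ) => (WithLp.toLp 2 fun i : Fin (dimSU N) => y (b, i) : ChartSU N) := by
    funext y b
    simp only [Function.comp_apply, MeasurableEquiv.piCongrLeft_apply_apply]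
  rwa [hfun] at h

/-- **FLAT FRAME → BLOCK CHART SPACE**: (M1) for `volume.withDensity (W ∘ unflat)` and `Ū ∘ unflat` on
`↥Λ × Fin d_N → ℝ` gives (M1) for `volume.withDensity W` and `Ū` on `BlockChartSU N Λ` (`W`, `Ū` measurable), same
constants (`T4ShellMeasureDet.slotAntiConcentration_withDensity_map` along `measurePreserving_unflat`). [bookkeeping] -/
theorem slotAntiConcentration_blockChartSU_of_unflat (Λ : Finset (PBond P j)) {W : BlockChartSU N Λ → ℝ≥0∞}
    (hW : Measurable W) {Ū : BlockChartSU N Λ → ℝ} (hŪ : Measurable Ū) {θ ρ D : ℝ}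
    (h : SlotAntiConcentration ((volume : Measure (↥Λ × Fin (dimSU N) → ℝ)).withDensity
        (W ∘ fun (y : ↥Λ × Fin (dimSU N) → ℝ) (b : ↥Λ) =>
          (WithLp.toLp 2 fun i : Fin (dimSU N) => y (b, i) : ChartSU N)))
      (Ū ∘ fun (y : ↥Λ × Fin (dimSU N) → ℝ) (b : ↥Λ) =>
          (WithLp.toLp 2 fun i : Fin (dimSU N) => y (b, i) : ChartSU N)) θ ρ D) :
    SlotAntiConcentration ((volume : Measure (BlockChartSU N Λ)).withDensity W) Ū θ ρ D :=
  slotAntiConcentration_withDensity_map (measurePreserving_unflat Λ) hW hŪ h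

/-! ## §4  The three steps at once: ★★★★'s frame to `hchart`'s frame -/

/-- ★ **FROM PART 34's CUT-RESTRICTED PRODUCT FRAME TO THE FLAT BLOCK CHART LAW.**  On `Unit × (↥Λ × Fin d_N → ℝ)`
(file 8 ★★★★ ∕ file 12 ★★★★ with `Z = Unit`): the conclusion
`SlotAntiConcentration ((((dirac ()) ⊗ volume).withDensity g)|({u<θ} ∩ C)) u θ ρ D` with the shell inside the cut `C`,
`g` and `u` measurable; the DICTIONARY (displayed — the consumer's): `g ((), y) = W (unflat y)` and `u ((), y) = Ū (unflat y)`
for the natural unflattening `unflat y = (b ↦ (y (b, i))_i)` (file 10 §5's chart point with prescribed flat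
coordinates); `W`, `Ū` measurable.  THEN `SlotAntiConcentration (volume.withDensity W) Ū θ ρ D` on `BlockChartSU N Λ`
— dag-n21-w2's `hchart` shape. [bookkeeping] -/
theorem slotAntiConcentration_blockChartSU_of_partFrame (Λ : Finset (PBond P j))
    {W : BlockChartSU N Λ → ℝ≥0∞} (hW : Measurable W) {Ū : BlockChartSU N Λ → ℝ} (hŪ : Measurable Ū)
    {g : Unit × (↥Λ × Fin (dimSU N) → ℝ) → ℝ≥0∞} (hg : Measurable g)
    {u : Unit × (↥Λ × Fin (dimSU N) → ℝ) → ℝ} (hu : Measurable u)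
    {C : Set (Unit × (↥Λ × Fin (dimSU N) → ℝ))} {θ ρ D : ℝ}
    (hC : ∀ p, θ * (1 - ρ) ≤ u p → u p < θ → p ∈ C)
    (hdictW : ∀ y : ↥Λ × Fin (dimSU N) → ℝ,
      g ((), y) = W (fun b : ↥Λ => (WithLp.toLp 2 fun i : Fin (dimSU N) => y (b, i) : ChartSU N)))
    (hdictU : ∀ y : ↥Λ × Fin (dimSU N) → ℝ,
      u ((), y) = Ū (fun b : ↥Λ => (WithLp.toLp 2 fun i : Fin (dimSU N) => y (b, i) : ChartSU N)))
    (h : SlotAntiConcentration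
      (((((Measure.dirac ()).prod (volume : Measure (↥Λ × Fin (dimSU N) → ℝ))).withDensity g).restrict
        ({p | u p < θ} ∩ C))) u θ ρ D) :
    SlotAntiConcentration ((volume : Measure (BlockChartSU N Λ)).withDensity W) Ū θ ρ D := by
  have h1 := slotAntiConcentration_of_restrict_cut _ hu hC h
  have h2 := slotAntiConcentration_of_dirac_prod (volume : Measure (↥Λ × Fin (dimSU N) → ℝ)) hg h1
  have hgW : (fun y : ↥Λ × Fin (dimSU N) → ℝ => g ((), y)) =
      W ∘ fun (y : ↥Λ × Fin (dimSU N) → ℝ) (b : ↥Λ) =>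
        (WithLp.toLp 2 fun i : Fin (dimSU N) => y (b, i) : ChartSU N) :=
    funext hdictW
  have huU : (fun y : ↥Λ × Fin (dimSU N) → ℝ => u ((), y)) =
      Ū ∘ fun (y : ↥Λ × Fin (dimSU N) → ℝ) (b : ↥Λ) =>
        (WithLp.toLp 2 fun i : Fin (dimSU N) => y (b, i) : ChartSU N) :=
    funext hdictU
  rw [hgW, huU] at h2
  exact slotAntiConcentration_blockChartSU_of_unflat Λ hW hŪ h2

end Summit.QuantumFields.YangMills.Theorems.N21ResponseRoadFrameTransfer
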